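/-
Copyright (c) 2026 the pub-hodgecm-mathlib formalisation cell (harness21).  R90-TF SLAB, section S10 (Rogawski 1990, §13.6–13.8 read at `v`), ROW 3∕ROW 6 of FILE D's twin —
the DISCRETE GERM COEFFICIENT OF RECORD `cDOf` as a ★ Theorems definition (RULING J-D8-1, dealer R90-C138-plan (g3) 2026-09-05T02:31:38Z; DEAL #50); bytes = R90-C138-typ2 (g3)'s
D ED. 5 probe `R90/R90-C138-typ2/g3/ProbeD_ed5_byimport.lean` a9308a6e13e02919 (D8-1) VERBATIM; filer K2Liu-p13 (g5).  h413 = `stmt-HodgeConjecture-24833`, route `HCCMUnconditional`.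
DEFINITIONS LANE (`--kind definition --supports stmt-HodgeConjecture-24833 --as helper`): ONE `def` with body + ONE `rfl` read-back; no instance, no notation, no named fact, no `sorry`; LAW L9 (★ `Theorems` imports only).
-/
import Summits.HodgeConjecture.HodgeConjecture.Theorems.R90S10FrozenFamilyMaps      -- ★ p863352 (W1-H3): `S10Frozen.ΦGu`, `unrUnit`, `UnrQs` (+ ★ C2 `S10FrozenDatum`, ★ E1 `DiscreteClass`, ★ `toAdelic`)
import HarnessLib

/-!
# R90-TF ∕ S10 — `cDOf`: THE DISCRETE GERM COEFFICIENT OF RECORD at the frozen family, `c_D(t)(φ) := Σ'_{c : evp c = t} m(c) · Tr c(ΦGu S 1_S φ)`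
# (`Theorems/R90S10DiscreteGermCoeffDefs.lean`; ns `Summit.HodgeConjecture.HodgeConjecture.R90.S10`; DEFINITIONS lane)

Cell `hodgecm-mathlib`, crux H413 (`stmt-HodgeConjecture-24833`), route of record `HCCMUnconditional`; programme R90-TF, section S10 (base `R90-C138`).
Print: [Rogawski1990] §13.8 display (13.8.3) p. 218 L5–7 («the sum is over cuspidal `π` on `G` such that `ψ_G(t(π)) = t`»); §13.6 p. 209 (e.v.p.'s `t(π)`); §13.7 line (3) p. 211
(the discrete part of the trace formula GROUPED BY e.v.p. germ).

## WHY A THEOREMS DEFS FILE (RULING J-D8-1)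
THREE ★ Theorems consumers need the discrete germ coefficient BY NAME — p04's ROW-3 FILE 2 conclusion `hd : DiscreteGermExpansionHyp … (cDOf 𝔣' S evp)`, p03's DEAL #48
skeleton, p08's keystone `sock₂Sig_of_inputs` — and Theorems files never import a `Cruxes/…/Lines` module; so `cDOf` is hosted HERE and FILE D ED. 5 (`Lines/R90_S10_TFDecompositionD`)
IMPORTS it (Lines ← Theorems).  Bytes = typ2 (g3)'s D ED. 5 probe (D8-1) VERBATIM, so (D8-2) `discreteCoeffAtT0Hyp_cDOf_of_letters` and (D8-3)
`stabilisedAtEvp_frozenFamily_of_tfBlocks₂_of_letters` stand token for token over this file.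

## CONTENTS
* `cDOf 𝔣 S evp t φ : ℂ` — for the frozen datum `𝔣 = ⟨𝔥, 𝔳, 𝔤⟩`, a level `S`, an e.v.p. map `evp : DiscreteClass U(Φ₃) μG → Germ` (parameter; of record `c ↦ ⟨germOfDiscreteClass S c, _⟩`),
  a germ `t` and a local test function `φ` at `v`: `Σ'_{c : evp c = t} m(c) · Tr c(toAdelic (𝔣.𝔳.ΦGu S (unrUnit L S) φ))` — the discrete side of (13.8.3) grouped by germ, on the
  frozen global test function with component `φ` at `v` and the unramified UNIT off `S` (★ W1-H3 `S10Frozen.ΦGu`, `unrUnit`; read into `C_c(G(𝔸), ℂ)` by ★ `toAdelic`).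
* `cDOf_apply` — the `rfl` read-back.
HONEST LABEL: a definition; pays no socket; HC_CM is proved only modulo the 7 printed citations (2 remaining named inputs: hLiu418 = `stmt-HodgeConjecture-24832`,
h413 = `stmt-HodgeConjecture-24833`) until rung 0 closes; REL ≠ ★ ≠ BUILT; count-neutral.
-/

set_option autoImplicit false
set_option linter.dupNamespace false

noncomputable section

namespace Summit.HodgeConjecture.HodgeConjecture.R90.S10

section PinnedCoeff

open scoped RestrictedProduct Matrix MatrixGroups
open Filter MeasureTheory NumberField IsDedekindDomain CompactlySupported
open Literature.NumberTheory.Rogawski1990 Literature.NumberTheory.Automorphic Literature.NumberTheory.Automorphic.UnitaryGroup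
open Literature.NumberTheory.Automorphic.UnitaryGroup.CotangentForms Literature.NumberTheory.GaloisRepresentations
open Literature.NumberTheory.Automorphic.Arthur2013.Leaves.TECR
open Summit.HodgeConjecture.HodgeConjecture.Cruxes.H413.K2E1TraceFormulaBeta
open Summit.HodgeConjecture.HodgeConjecture.Cruxes.H413.K2E1SpectralTermsDiscreteHalf
open Summit.HodgeConjecture.HodgeConjecture.Cruxes.H413.K2E1GlobalTestFunctions

variable {L : Type} [Field L] [NumberField L] [IsCMField L] [DecidableEq (Pl L)] {μ : HeckeCharacter L} {v : Pl L}
  [MeasurableSpace (HLoc L v)] [BorelSpace (HLoc L v)] [MeasurableSpace (Gqs L v)] [BorelSpace (Gqs L v)]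
  {νHv : Measure (HLoc L v)} {νQv : Measure (Gqs L v)} [νHv.IsHaarMeasure] [νHv.IsMulRightInvariant] [νQv.IsHaarMeasure] [νQv.IsMulRightInvariant]
  [∀ a : HLoc L v, MeasurableSpace (HLoc L v ⧸ Subgroup.centralizer ({a} : Set (HLoc L v)))]
  [∀ a : HLoc L v, BorelSpace (HLoc L v ⧸ Subgroup.centralizer ({a} : Set (HLoc L v)))]
  [∀ γ : Gqs L v, MeasurableSpace (Gqs L v ⧸ Subgroup.centralizer ({γ} : Set (Gqs L v)))]
  [∀ γ : Gqs L v, BorelSpace (Gqs L v ⧸ Subgroup.centralizer ({γ} : Set (Gqs L v)))]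
  {mHv : OrbitalMeasureFamily (HLoc L v)} {mQv : OrbitalMeasureFamily (Gqs L v)} {πSt : IrrClass (HLoc L v)}
  [MeasurableSpace (G3 L).Adelic] [BorelSpace (G3 L).Adelic] [MeasurableSpace (H2 L).Adelic] [BorelSpace (H2 L).Adelic]
  [MeasurableSpace (GArch L)] [BorelSpace (GArch L)] [MeasurableSpace (HArch L)] [BorelSpace (HArch L)]
  [MeasurableSpace (H1Loc L v)] [MeasurableSpace (H1Arch L)] [MeasurableSpace (H1 L).Adelic] [BorelSpace (H1 L).Adelic]

/-- **`cDOf 𝔣 S evp` — THE DISCRETE GERM COEFFICIENT OF RECORD at the frozen family**: `c_D(t)(φ) := Σ'_{c : evp c = t} m(c) · Tr c(ΦGu S 1_S φ)` — the discrete side of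
(13.8.3) GROUPED BY e.v.p. GERM `t`, evaluated on the frozen global test function with local component `φ` at `v` and the unramified UNIT off `S` (★ W1-H3 `unrUnit`,
`S10Frozen.ΦGu`; read back into `C_c(G(𝔸), ℂ)` by ★ `toAdelic`).  This is the `cD` the keystone (p08 DEAL #37) and row 6 (★ p864471) speak of; `evp` (the e.v.p. map,
of record `c ↦ ⟨germOfDiscreteClass S c, germOfDiscreteClass_mem_germSub S c⟩` at `bd := bdRec`, `σ := σRec`) and its target `Germ` stay PARAMETERS here.
[cite: Rogawski1990, §13.8 display (13.8.3) p. 218 L5–7; §13.6 p. 209; §13.7 line (3) p. 211] -/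
def cDOf (𝔣 : S10FrozenDatum L μ v νHv νQv mHv mQv πSt) (S : Set (Pl L)) {Germ : Type*}
    (evp : (haveI := 𝔣.𝔤.hμG; DiscreteClass (G3 L) 𝔣.𝔤.μG) → Germ) (t : Germ) (φ : Gqs L v → ℂ) : ℂ :=
  haveI := 𝔣.𝔤.hμG
  haveI := 𝔣.𝔤.hνG
  ∑' q : {c : DiscreteClass (G3 L) 𝔣.𝔤.μG // evp c = t},
    ((q.1.mult).toNat : ℂ) * q.1.classTrace 𝔣.𝔤.νG (toAdelic (𝔣.𝔳.ΦGu S (unrUnit L S) φ))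

/-- **Read-back of `cDOf`** (`rfl`): `cDOf 𝔣 S evp t φ = Σ'_{c : evp c = t} m(c) · Tr c(toAdelic (𝔣.𝔳.ΦGu S (unrUnit L S) φ))`. [cite: Rogawski1990, §13.8 display (13.8.3) p. 218 L5–7] -/
theorem cDOf_apply (𝔣 : S10FrozenDatum L μ v νHv νQv mHv mQv πSt) (S : Set (Pl L)) {Germ : Type*}
    (evp : (haveI := 𝔣.𝔤.hμG; DiscreteClass (G3 L) 𝔣.𝔤.μG) → Germ) (t : Germ) (φ : Gqs L v → ℂ) :
    cDOf 𝔣 S evp t φ =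
      (haveI := 𝔣.𝔤.hμG
       haveI := 𝔣.𝔤.hνG
       ∑' q : {c : DiscreteClass (G3 L) 𝔣.𝔤.μG // evp c = t},
        ((q.1.mult).toNat : ℂ) * q.1.classTrace 𝔣.𝔤.νG (toAdelic (𝔣.𝔳.ΦGu S (unrUnit L S) φ))) :=
  rfl

end PinnedCoeff

end Summit.HodgeConjecture.HodgeConjecture.R90.S10

end
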